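import Summits.QuantumFields.YangMills.Theorems.ToronValleyVolumeNearlyCommutingCeilingSection
import Summits.QuantumFields.YangMills.Theorems.SwapTwistDeficitToronLog
import HarnessLib

/-!
# The 4-letter commutator small ball, CEILING side — II: `Haar⁴{pairwise ‖[q_μ, q_ν]‖ ≤ t} ≤ C·t⁶·log(1/t)`

Second (final) file of the companion upper bound to ✓`ToronLog.haar_pi_nearlyCommuting_ge` (w2 g54): together they pin the `k = 4`
zero-mode block of the toron valley (crux ⟨stmt-QuantumFields-24497⟩ `ToronValleyVolume.ToronTubeVolumeLaw`, central strata) at small-ball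
exponent `6` with EXACTLY ONE logarithm — `c·t⁶·log(1/t) ≤ Haar⁴(nearlyCommuting t) ≤ C·t⁶·log(1/t)` for small `t`.

Argument (ball model ✓`coneMeasure`, ✓`measurePreserving_proj`): normalising letters of norm `< 1` only enlarges commutators, so the event pulls
back into `G_t = {x ∈ ℍ⁴ | ∀ μ ν, ‖x_μ x_ν − x_ν x_μ‖ ≤ t}`; distinguishing the letter `μ*` with the largest `‖Im x_μ‖ =: m`, the other three
letters lie in the section of part I, of cone mass `≤ min(1, c·4t²/m)` each (✓`coneMeasure_section_le`); Fubini over `x_{μ*}`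
(✓`measurePreserving_piFinSuccAbove`) and the dyadic shells `2^{-(k+1)} < m ≤ 2^{-k}` (cone mass `≤ 16c·2^{-3k}`, ✓`coneMeasure_imBall_le`)
give `Σ_{k ≤ K} (c·4t²·2^{k+1})³·16c·2^{-3k} + 16c·2^{-3(K+1)} = 8192c⁴t⁶(K+1) + O(t⁶)` with `2^{K} ≤ t⁻² < 2^{K+1}`, i.e. `K + 1 ≤ 3log(1/t)/log 2`.
* §4 the product form of the section event and its measurability; §5 `G_t ⊆ ⋃_μ (split at μ)⁻¹(product form)` and the pull-back;
* §6 the shell bound for `∫ (cone S_y)³ dcone(y)`; §7 ★★ `haar_pi_nearlyCommuting_le`.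
HONEST LABEL: finite-dimensional volume bookkeeping toward the fixed-`L` zero-mode factor of ⟨24497⟩; nothing about ⟨24497⟩/⟨24196⟩ or any rung is
proved; the Yang–Mills mass gap is NOT proved; no summit is proved by a line.  Seat ym-line-fcl-p3 g43 (cell ym-idea-1, free hands;
`--supports stmt-QuantumFields-24497`).  THEOREMS ONLY (0 `def`, 0 `sorry`), standard axioms.  References: [cite: Vanbaal2001]; [cite: Luscher1983, §2]; [folklore].
-/

set_option autoImplicit false

noncomputable section

open MeasureTheory Quaternion Set
open scoped Quaternion ENNReal BigOperators
open Literature.MathematicalPhysics.QuantumLattice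
open Literature.MathematicalPhysics.QuantumFieldTheory (haarProbability)
open Summit.QuantumFields.YangMills.Theorems.SwapTwistDeficit.ToronLog

attribute [local instance] Literature.Analysis.FluidPDE.Tao2016.quatMeasurableSpace
  Literature.Analysis.FluidPDE.Tao2016.quatBorelSpace
  Literature.MathematicalPhysics.QuantumLattice.secondCountableTopology_su2

namespace Summit.QuantumFields.YangMills.Theorems.ToronValleyVolume.NearlyCommutingCeiling

/-! ## §4 The product form of the section event -/

/-- The product form `{(y, w) | ∀ j, ‖Im w_j‖ ≤ ‖Im y‖ ∧ ‖y w_j − w_j y‖ ≤ t}` is measurable. [folklore] -/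
theorem measurableSet_sprod (t : ℝ) :
    MeasurableSet {p : ℍ × (Fin 3 → ℍ) | ∀ j : Fin 3, ‖(p.2 j).im‖ ≤ ‖p.1.im‖ ∧ ‖p.1 * p.2 j - p.2 j * p.1‖ ≤ t} := by
  have h1 : ∀ j : Fin 3, MeasurableSet {p : ℍ × (Fin 3 → ℍ) | ‖(p.2 j).im‖ ≤ ‖p.1.im‖} := fun j =>
    measurableSet_le ((continuous_norm.comp (continuous_im.comp ((continuous_apply j).comp continuous_snd))).measurable)
      ((continuous_norm.comp (continuous_im.comp continuous_fst)).measurable)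
  have h2 : ∀ j : Fin 3, MeasurableSet {p : ℍ × (Fin 3 → ℍ) | ‖p.1 * p.2 j - p.2 j * p.1‖ ≤ t} := by
    intro j
    have hc : Continuous fun p : ℍ × (Fin 3 → ℍ) => ‖p.1 * p.2 j - p.2 j * p.1‖ := by fun_prop
    exact measurableSet_le hc.measurable measurable_const
  have e : {p : ℍ × (Fin 3 → ℍ) | ∀ j : Fin 3, ‖(p.2 j).im‖ ≤ ‖p.1.im‖ ∧ ‖p.1 * p.2 j - p.2 j * p.1‖ ≤ t} =
      ⋂ j : Fin 3, ({p : ℍ × (Fin 3 → ℍ) | ‖(p.2 j).im‖ ≤ ‖p.1.im‖} ∩ {p | ‖p.1 * p.2 j - p.2 j * p.1‖ ≤ t}) := by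
    ext p
    simp only [Set.mem_setOf_eq, Set.mem_iInter, Set.mem_inter_iff]
  rw [e]
  exact MeasurableSet.iInter fun j => (h1 j).inter (h2 j)

/-- The section of the product form over `y` is the cube of the one-letter section. [folklore] -/
theorem mk_preimage_sprod (t : ℝ) (y : ℍ) :
    Prod.mk y ⁻¹' {p : ℍ × (Fin 3 → ℍ) | ∀ j : Fin 3, ‖(p.2 j).im‖ ≤ ‖p.1.im‖ ∧ ‖p.1 * p.2 j - p.2 j * p.1‖ ≤ t} =
      Set.pi Set.univ fun _ : Fin 3 => {w : ℍ | ‖w.im‖ ≤ ‖y.im‖ ∧ ‖y * w - w * y‖ ≤ t} := by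
  ext f
  simp

/-- **Fubini over the distinguished letter**: the product cone mass of the split event is `∫ (cone S_y)³ dcone(y)`. [folklore] -/
theorem pi_preimage_split_eq (t : ℝ) (μ : Fin 4) :
    (Measure.pi fun _ : Fin 4 => coneMeasure)
        ((MeasurableEquiv.piFinSuccAbove (fun _ : Fin 4 => ℍ) μ) ⁻¹'
          {p : ℍ × (Fin 3 → ℍ) | ∀ j : Fin 3, ‖(p.2 j).im‖ ≤ ‖p.1.im‖ ∧ ‖p.1 * p.2 j - p.2 j * p.1‖ ≤ t}) =
      ∫⁻ y, coneMeasure {w : ℍ | ‖w.im‖ ≤ ‖y.im‖ ∧ ‖y * w - w * y‖ ≤ t} ^ 3 ∂coneMeasure := by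
  haveI := isProbabilityMeasure_coneMeasure
  have hS := measurableSet_sprod t
  rw [(measurePreserving_piFinSuccAbove (fun _ : Fin 4 => coneMeasure) μ).measure_preimage hS.nullMeasurableSet,
    Measure.prod_apply hS]
  refine lintegral_congr fun y => ?_
  rw [mk_preimage_sprod, Measure.pi_pi, Finset.prod_const, Finset.card_univ, Fintype.card_fin]

/-! ## §5 The commutator event in the ball model and its splitting by the largest imaginary part -/

/-- **Pull-back**: a point of the ball model whose NORMALISED letters pairwise commute up to `t` has its letters pairwise commuting
up to `t` (normalising letters of norm `< 1` enlarges commutators, ✓`norm_comm_smul`). [folklore] -/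
theorem proj_preimage_inter_ball_subset {t : ℝ} (ht : 0 ≤ t) :
    ((fun (x : Fin 4 → ℍ) (μ : Fin 4) => quatToSU2 (x μ)) ⁻¹' nearlyCommuting t) ∩ Set.pi Set.univ (fun _ : Fin 4 => Metric.ball (0 : ℍ) 1) ⊆
      {x : Fin 4 → ℍ | ∀ μ ν : Fin 4, ‖x μ * x ν - x ν * x μ‖ ≤ t} := by
  intro x hx
  simp only [Set.mem_inter_iff, Set.mem_preimage, nearlyCommuting, Set.mem_setOf_eq, Set.mem_pi, Set.mem_univ, true_implies,
    Metric.mem_ball, dist_zero_right] at hx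
  obtain ⟨hcomm, hball⟩ := hx
  intro μ ν
  by_cases hμ : x μ = 0
  · rw [hμ, zero_mul, mul_zero, sub_zero, norm_zero]; exact ht
  by_cases hν : x ν = 0
  · rw [hν, zero_mul, mul_zero, sub_zero, norm_zero]; exact ht
  have h := hcomm μ ν
  rw [Literature.MathematicalPhysics.QuantumFieldTheory.Balaban1983to89.T4HaarSU2Translate.su2Quat_quatToSU2 hμ,
    Literature.MathematicalPhysics.QuantumFieldTheory.Balaban1983to89.T4HaarSU2Translate.su2Quat_quatToSU2 hν,
    norm_comm_smul, abs_of_pos (inv_pos.2 (norm_pos_iff.2 hμ)), abs_of_pos (inv_pos.2 (norm_pos_iff.2 hν))] at h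
  have ha : 1 ≤ ‖x μ‖⁻¹ := (one_le_inv₀ (norm_pos_iff.2 hμ)).2 (hball μ).le
  have hb : 1 ≤ ‖x ν‖⁻¹ := (one_le_inv₀ (norm_pos_iff.2 hν)).2 (hball ν).le
  have hab : 1 ≤ ‖x μ‖⁻¹ * ‖x ν‖⁻¹ := one_le_mul_of_one_le_of_one_le ha hb
  have hn : 0 ≤ ‖x μ * x ν - x ν * x μ‖ := norm_nonneg _
  nlinarith

/-- **Splitting by the largest imaginary part**: `G_t ⊆ ⋃_μ (split at μ)⁻¹ (product form)`. [folklore] -/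
theorem commSet_subset_iUnion (t : ℝ) :
    {x : Fin 4 → ℍ | ∀ μ ν : Fin 4, ‖x μ * x ν - x ν * x μ‖ ≤ t} ⊆
      ⋃ μ : Fin 4, (MeasurableEquiv.piFinSuccAbove (fun _ : Fin 4 => ℍ) μ) ⁻¹'
        {p : ℍ × (Fin 3 → ℍ) | ∀ j : Fin 3, ‖(p.2 j).im‖ ≤ ‖p.1.im‖ ∧ ‖p.1 * p.2 j - p.2 j * p.1‖ ≤ t} := by
  intro x hx
  simp only [Set.mem_setOf_eq] at hx
  obtain ⟨μ, -, hμ⟩ := Finset.exists_max_image Finset.univ (fun ν : Fin 4 => ‖(x ν).im‖) Finset.univ_nonempty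
  refine Set.mem_iUnion.2 ⟨μ, ?_⟩
  simp only [Set.mem_preimage, MeasurableEquiv.piFinSuccAbove_apply, Fin.insertNthEquiv, Equiv.coe_fn_symm_mk, Set.mem_setOf_eq,
    Fin.removeNth]
  intro j
  exact ⟨hμ _ (Finset.mem_univ _), hx μ (μ.succAbove j)⟩

/-- The product cone measure gives full mass to the product of unit balls. [folklore] -/
theorem pi_coneMeasure_compl_piBall : (Measure.pi fun _ : Fin 4 => coneMeasure) (Set.pi Set.univ (fun _ : Fin 4 => Metric.ball (0 : ℍ) 1))ᶜ = 0 := by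
  haveI := isProbabilityMeasure_coneMeasure
  have hball : coneMeasure (Metric.ball (0 : ℍ) 1) = 1 := by
    rw [coneMeasure_apply measurableSet_ball subset_rfl, ENNReal.inv_mul_cancel volume_ball_quat_ne_zero volume_ball_quat_ne_top]
  have h1 : (Measure.pi fun _ : Fin 4 => coneMeasure) (Set.pi Set.univ (fun _ : Fin 4 => Metric.ball (0 : ℍ) 1)) = 1 := by
    rw [Measure.pi_pi]; simp [hball]
  rw [measure_compl (MeasurableSet.univ_pi fun _ => measurableSet_ball) (measure_ne_top _ _), h1, measure_univ, tsub_self]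

/-- ★ **Haar mass ≤ sum over the distinguished letter of the shell integrals.** [folklore] -/
theorem haar_pi_le_sum_lintegral {t : ℝ} (ht : 0 ≤ t) :
    (Measure.pi fun _ : Fin 4 => haarProbability (Matrix.specialUnitaryGroup (Fin 2) ℂ)) (nearlyCommuting t) ≤
      ∑ _μ : Fin 4, ∫⁻ y, coneMeasure {w : ℍ | ‖w.im‖ ≤ ‖y.im‖ ∧ ‖y * w - w * y‖ ≤ t} ^ 3 ∂coneMeasure := by
  have hE := measurableSet_nearlyCommuting t
  rw [← measurePreserving_proj.measure_preimage hE.nullMeasurableSet]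
  set P := (fun (x : Fin 4 → ℍ) (μ : Fin 4) => quatToSU2 (x μ)) ⁻¹' nearlyCommuting t with hP
  set B := Set.pi Set.univ (fun _ : Fin 4 => Metric.ball (0 : ℍ) 1) with hB
  calc (Measure.pi fun _ : Fin 4 => coneMeasure) P
      ≤ (Measure.pi fun _ : Fin 4 => coneMeasure) (P ∩ B ∪ Bᶜ) := measure_mono (fun x hx => by
          by_cases hb : x ∈ B
          · exact Or.inl ⟨hx, hb⟩
          · exact Or.inr hb)
    _ ≤ (Measure.pi fun _ : Fin 4 => coneMeasure) (P ∩ B) + (Measure.pi fun _ : Fin 4 => coneMeasure) Bᶜ := measure_union_le _ _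
    _ = (Measure.pi fun _ : Fin 4 => coneMeasure) (P ∩ B) := by rw [pi_coneMeasure_compl_piBall, add_zero]
    _ ≤ (Measure.pi fun _ : Fin 4 => coneMeasure) (⋃ μ : Fin 4, (MeasurableEquiv.piFinSuccAbove (fun _ : Fin 4 => ℍ) μ) ⁻¹'
          {p : ℍ × (Fin 3 → ℍ) | ∀ j : Fin 3, ‖(p.2 j).im‖ ≤ ‖p.1.im‖ ∧ ‖p.1 * p.2 j - p.2 j * p.1‖ ≤ t}) :=
        measure_mono ((proj_preimage_inter_ball_subset ht).trans (commSet_subset_iUnion t))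
    _ ≤ ∑ μ : Fin 4, (Measure.pi fun _ : Fin 4 => coneMeasure) ((MeasurableEquiv.piFinSuccAbove (fun _ : Fin 4 => ℍ) μ) ⁻¹'
          {p : ℍ × (Fin 3 → ℍ) | ∀ j : Fin 3, ‖(p.2 j).im‖ ≤ ‖p.1.im‖ ∧ ‖p.1 * p.2 j - p.2 j * p.1‖ ≤ t}) :=
        measure_iUnion_fintype_le _ _
    _ = ∑ _μ : Fin 4, ∫⁻ y, coneMeasure {w : ℍ | ‖w.im‖ ≤ ‖y.im‖ ∧ ‖y * w - w * y‖ ≤ t} ^ 3 ∂coneMeasure :=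
        Finset.sum_congr rfl fun μ _ => pi_preimage_split_eq t μ

/-! ## §6 The dyadic shell bound for the integrand -/

/-- Every `m ∈ (2^{-(K+1)}, 1]` lies in a dyadic shell `(2^{-(k+1)}, 2^{-k}]` with `k ≤ K`. [folklore] -/
theorem exists_shell {m : ℝ} {K : ℕ} (hm1 : m ≤ 1) (hmK : (1 / 2 : ℝ) ^ (K + 1) < m) :
    ∃ k ∈ Finset.range (K + 1), (1 / 2 : ℝ) ^ (k + 1) < m ∧ m ≤ (1 / 2) ^ k := by
  have hm0 : 0 < m := lt_trans (by positivity) hmK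
  have hx1 : 1 ≤ m⁻¹ := (one_le_inv₀ hm0).2 hm1
  obtain ⟨k, hk1, hk2⟩ := exists_nat_pow_near hx1 (by norm_num : (1 : ℝ) < 2)
  refine ⟨k, Finset.mem_range.2 ?_, ?_, ?_⟩
  · -- `2^k ≤ m⁻¹ < 2^{K+1}`
    have hK' : m⁻¹ < (2 : ℝ) ^ (K + 1) := by
      rw [one_div, inv_pow] at hmK
      have := (inv_lt_inv₀ hm0 (by positivity)).2 hmK
      rwa [inv_inv] at this
    have h : (2 : ℝ) ^ k < 2 ^ (K + 1) := lt_of_le_of_lt hk1 hK'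
    have := (pow_lt_pow_iff_right₀ (by norm_num : (1 : ℝ) < 2)).1 h
    omega
  · rw [one_div, inv_pow, inv_lt_comm₀ (by positivity) hm0]; exact hk2
  · rw [one_div, inv_pow, le_inv_comm₀ hm0 (by positivity)]; exact hk1

/-- ★ **Pointwise shell bound**: with `a_k = (c·4t²·2^{k+1})³`,
`(cone S_y)³ ≤ Σ_{k ≤ K} a_k·𝟙{2^{-(k+1)} < ‖Im y‖ ≤ 2^{-k}} + 𝟙{‖Im y‖ ≤ 2^{-(K+1)}} + 𝟙{1 < ‖Im y‖}`. [folklore] -/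
theorem integrand_le_shellSum {t : ℝ} (ht : 0 ≤ t) (K : ℕ) (y : ℍ) :
    coneMeasure {w : ℍ | ‖w.im‖ ≤ ‖y.im‖ ∧ ‖y * w - w * y‖ ≤ t} ^ 3 ≤
      (∑ k ∈ Finset.range (K + 1),
          {z : ℍ | (1 / 2 : ℝ) ^ (k + 1) < ‖z.im‖ ∧ ‖z.im‖ ≤ (1 / 2) ^ k}.indicator
            (fun _ => ENNReal.ofReal ((coneConst * (4 * t ^ 2 * 2 ^ (k + 1))) ^ 3)) y) +
        {z : ℍ | ‖z.im‖ ≤ (1 / 2 : ℝ) ^ (K + 1)}.indicator (fun _ => (1 : ℝ≥0∞)) y +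
        {z : ℍ | 1 < ‖z.im‖}.indicator (fun _ => (1 : ℝ≥0∞)) y := by
  have h1 : coneMeasure {w : ℍ | ‖w.im‖ ≤ ‖y.im‖ ∧ ‖y * w - w * y‖ ≤ t} ^ 3 ≤ 1 := by
    calc coneMeasure {w : ℍ | ‖w.im‖ ≤ ‖y.im‖ ∧ ‖y * w - w * y‖ ≤ t} ^ 3 ≤ 1 ^ 3 := by
          gcongr; exact coneMeasure_le_one _
      _ = 1 := one_pow 3
  by_cases htop : 1 < ‖y.im‖
  · have : {z : ℍ | 1 < ‖z.im‖}.indicator (fun _ => (1 : ℝ≥0∞)) y = 1 := Set.indicator_of_mem (by exact htop) _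
    rw [this]
    exact h1.trans (le_add_self)
  by_cases hbot : ‖y.im‖ ≤ (1 / 2 : ℝ) ^ (K + 1)
  · have : {z : ℍ | ‖z.im‖ ≤ (1 / 2 : ℝ) ^ (K + 1)}.indicator (fun _ => (1 : ℝ≥0∞)) y = 1 := Set.indicator_of_mem (by exact hbot) _
    rw [this]
    exact h1.trans (le_add_right le_add_self)
  -- the dyadic shell of `‖Im y‖`
  obtain ⟨k, hk, hlo, hhi⟩ := exists_shell (not_lt.1 htop) (not_le.1 hbot)
  have hm : 0 < ‖y.im‖ := lt_trans (by positivity) hlo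
  have hy : y.im ≠ 0 := norm_pos_iff.1 hm
  have hsec := coneMeasure_section_le ht hy
  have hterm : coneMeasure {w : ℍ | ‖w.im‖ ≤ ‖y.im‖ ∧ ‖y * w - w * y‖ ≤ t} ^ 3 ≤
      ENNReal.ofReal ((coneConst * (4 * t ^ 2 * 2 ^ (k + 1))) ^ 3) := by
    have hc := coneConst_pos
    have hle : coneConst * (4 * t ^ 2 / ‖y.im‖) ≤ coneConst * (4 * t ^ 2 * 2 ^ (k + 1)) := by
      refine mul_le_mul_of_nonneg_left ?_ hc.le
      rw [div_le_iff₀ hm]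
      have h2 : (1 : ℝ) < 2 ^ (k + 1) * ‖y.im‖ := by
        rw [one_div, inv_pow] at hlo
        have := (inv_lt_iff_one_lt_mul₀ (by positivity)).1 hlo
        linarith
      nlinarith [sq_nonneg t]
    calc coneMeasure {w : ℍ | ‖w.im‖ ≤ ‖y.im‖ ∧ ‖y * w - w * y‖ ≤ t} ^ 3
        ≤ (ENNReal.ofReal (coneConst * (4 * t ^ 2 * 2 ^ (k + 1)))) ^ 3 := by
          gcongr
          exact hsec.trans (ENNReal.ofReal_le_ofReal hle)
      _ = ENNReal.ofReal ((coneConst * (4 * t ^ 2 * 2 ^ (k + 1))) ^ 3) := by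
          rw [ENNReal.ofReal_pow (by positivity)]
  have hind : {z : ℍ | (1 / 2 : ℝ) ^ (k + 1) < ‖z.im‖ ∧ ‖z.im‖ ≤ (1 / 2) ^ k}.indicator
      (fun _ => ENNReal.ofReal ((coneConst * (4 * t ^ 2 * 2 ^ (k + 1))) ^ 3)) y =
        ENNReal.ofReal ((coneConst * (4 * t ^ 2 * 2 ^ (k + 1))) ^ 3) := Set.indicator_of_mem (by exact ⟨hlo, hhi⟩) _
  have hsum : ENNReal.ofReal ((coneConst * (4 * t ^ 2 * 2 ^ (k + 1))) ^ 3) ≤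
      ∑ k ∈ Finset.range (K + 1), {z : ℍ | (1 / 2 : ℝ) ^ (k + 1) < ‖z.im‖ ∧ ‖z.im‖ ≤ (1 / 2) ^ k}.indicator
        (fun _ => ENNReal.ofReal ((coneConst * (4 * t ^ 2 * 2 ^ (k + 1))) ^ 3)) y := by
    rw [← hind]
    exact Finset.single_le_sum (f := fun k => {z : ℍ | (1 / 2 : ℝ) ^ (k + 1) < ‖z.im‖ ∧ ‖z.im‖ ≤ (1 / 2) ^ k}.indicator
        (fun _ => ENNReal.ofReal ((coneConst * (4 * t ^ 2 * 2 ^ (k + 1))) ^ 3)) y) (fun _ _ => zero_le) hk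
  exact (hterm.trans hsum).trans (le_trans le_self_add le_self_add)

/-- The dyadic shells are measurable. [folklore] -/
theorem measurableSet_shell (k : ℕ) : MeasurableSet {z : ℍ | (1 / 2 : ℝ) ^ (k + 1) < ‖z.im‖ ∧ ‖z.im‖ ≤ (1 / 2) ^ k} :=
  (measurableSet_imBall_compl _).inter (measurableSet_imBall _)

/-- Cone mass of a dyadic shell: `≤ 16c·2^{-3k}`. [folklore] -/
theorem coneMeasure_shell_le (k : ℕ) :
    coneMeasure {z : ℍ | (1 / 2 : ℝ) ^ (k + 1) < ‖z.im‖ ∧ ‖z.im‖ ≤ (1 / 2) ^ k} ≤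
      ENNReal.ofReal (coneConst * (16 * ((1 / 2 : ℝ) ^ k) ^ 3)) :=
  (measure_mono fun z hz => hz.2).trans (coneMeasure_imBall_le (by positivity))

/-- Integral of a shell step function: `∫ (Σ_k a_k 𝟙_{D_k} + 𝟙_B + 𝟙_T) dμ = Σ_k a_k μ(D_k) + μ(B) + μ(T)`. [folklore] -/
theorem lintegral_shellSum_eq (μ : Measure ℍ) (D : ℕ → Set ℍ) (hD : ∀ k, MeasurableSet (D k)) (a : ℕ → ℝ≥0∞) (B T : Set ℍ)
    (hB : MeasurableSet B) (hT : MeasurableSet T) (K : ℕ) :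
    ∫⁻ y, ((∑ k ∈ Finset.range (K + 1), (D k).indicator (fun _ => a k) y) + B.indicator (fun _ => (1 : ℝ≥0∞)) y +
        T.indicator (fun _ => (1 : ℝ≥0∞)) y) ∂μ =
      (∑ k ∈ Finset.range (K + 1), a k * μ (D k)) + μ B + μ T := by
  have hmeas : ∀ k : ℕ, Measurable fun y : ℍ => (D k).indicator (fun _ => a k) y := fun k => measurable_const.indicator (hD k)
  have hS : Measurable fun y : ℍ => ∑ k ∈ Finset.range (K + 1), (D k).indicator (fun _ => a k) y :=
    Finset.measurable_sum _ fun k _ => hmeas k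
  have hBm : Measurable fun y : ℍ => B.indicator (fun _ => (1 : ℝ≥0∞)) y := measurable_const.indicator hB
  have hSB : Measurable fun y : ℍ => (∑ k ∈ Finset.range (K + 1), (D k).indicator (fun _ => a k) y) + B.indicator (fun _ => (1 : ℝ≥0∞)) y :=
    hS.add hBm
  have e1 : ∫⁻ y, ((∑ k ∈ Finset.range (K + 1), (D k).indicator (fun _ => a k) y) + B.indicator (fun _ => (1 : ℝ≥0∞)) y +
        T.indicator (fun _ => (1 : ℝ≥0∞)) y) ∂μ =
      ∫⁻ y, ((∑ k ∈ Finset.range (K + 1), (D k).indicator (fun _ => a k) y) + B.indicator (fun _ => (1 : ℝ≥0∞)) y) ∂μ +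
        ∫⁻ y, T.indicator (fun _ => (1 : ℝ≥0∞)) y ∂μ := lintegral_add_left hSB _
  have e2 : ∫⁻ y, ((∑ k ∈ Finset.range (K + 1), (D k).indicator (fun _ => a k) y) + B.indicator (fun _ => (1 : ℝ≥0∞)) y) ∂μ =
      ∫⁻ y, (∑ k ∈ Finset.range (K + 1), (D k).indicator (fun _ => a k) y) ∂μ + ∫⁻ y, B.indicator (fun _ => (1 : ℝ≥0∞)) y ∂μ :=
    lintegral_add_left hS _
  have e3 : ∫⁻ y, (∑ k ∈ Finset.range (K + 1), (D k).indicator (fun _ => a k) y) ∂μ =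
      ∑ k ∈ Finset.range (K + 1), ∫⁻ y, (D k).indicator (fun _ => a k) y ∂μ :=
    lintegral_finsetSum _ fun k _ => hmeas k
  have e4 : ∀ k : ℕ, ∫⁻ y, (D k).indicator (fun _ => a k) y ∂μ = a k * μ (D k) := fun k => lintegral_indicator_const (hD k) _
  have e5 : ∫⁻ y, B.indicator (fun _ => (1 : ℝ≥0∞)) y ∂μ = μ B := by rw [lintegral_indicator_const hB, one_mul]
  have e6 : ∫⁻ y, T.indicator (fun _ => (1 : ℝ≥0∞)) y ∂μ = μ T := by rw [lintegral_indicator_const hT, one_mul]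
  rw [e1, e2, e3, e5, e6, Finset.sum_congr rfl fun k _ => e4 k]

/-- ★ **The shell integral**: `∫ (cone S_y)³ dcone(y) ≤ (K+1)·8192c⁴t⁶ + 16c·2^{-3(K+1)}`. [folklore] -/
theorem lintegral_integrand_le {t : ℝ} (ht : 0 ≤ t) (K : ℕ) :
    ∫⁻ y, coneMeasure {w : ℍ | ‖w.im‖ ≤ ‖y.im‖ ∧ ‖y * w - w * y‖ ≤ t} ^ 3 ∂coneMeasure ≤
      ENNReal.ofReal (((K + 1 : ℕ) : ℝ) * (8192 * coneConst ^ 4 * t ^ 6) + coneConst * (16 * ((1 / 2 : ℝ) ^ (K + 1)) ^ 3)) := by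
  have hc := coneConst_pos
  -- integrate the shell bound
  refine (lintegral_mono fun y => integrand_le_shellSum ht K y).trans ?_
  have E := lintegral_shellSum_eq coneMeasure (fun k => {z : ℍ | (1 / 2 : ℝ) ^ (k + 1) < ‖z.im‖ ∧ ‖z.im‖ ≤ (1 / 2) ^ k})
    measurableSet_shell (fun k => ENNReal.ofReal ((coneConst * (4 * t ^ 2 * 2 ^ (k + 1))) ^ 3)) {z : ℍ | ‖z.im‖ ≤ (1 / 2 : ℝ) ^ (K + 1)}
    {z : ℍ | 1 < ‖z.im‖} (measurableSet_imBall _) (measurableSet_imBall_compl _) K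
  refine (le_of_eq E).trans ?_
  rw [coneMeasure_imBall_compl_one, add_zero]
  -- the shell terms are each `≤ 8192 c⁴ t⁶`
  have hterm : ∀ k ∈ Finset.range (K + 1),
      ENNReal.ofReal ((coneConst * (4 * t ^ 2 * 2 ^ (k + 1))) ^ 3) *
          coneMeasure {z : ℍ | (1 / 2 : ℝ) ^ (k + 1) < ‖z.im‖ ∧ ‖z.im‖ ≤ (1 / 2) ^ k} ≤
        ENNReal.ofReal (8192 * coneConst ^ 4 * t ^ 6) := by
    intro k _
    calc ENNReal.ofReal ((coneConst * (4 * t ^ 2 * 2 ^ (k + 1))) ^ 3) *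
          coneMeasure {z : ℍ | (1 / 2 : ℝ) ^ (k + 1) < ‖z.im‖ ∧ ‖z.im‖ ≤ (1 / 2) ^ k}
        ≤ ENNReal.ofReal ((coneConst * (4 * t ^ 2 * 2 ^ (k + 1))) ^ 3) * ENNReal.ofReal (coneConst * (16 * ((1 / 2 : ℝ) ^ k) ^ 3)) :=
          mul_le_mul_right (coneMeasure_shell_le k) _
      _ = ENNReal.ofReal (8192 * coneConst ^ 4 * t ^ 6) := by
          rw [← ENNReal.ofReal_mul (by positivity)]
          congr 1
          have h2 : (2 : ℝ) ^ (k + 1) * (1 / 2) ^ k = 2 := by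
            rw [pow_succ, one_div, inv_pow, mul_assoc, mul_comm (2 : ℝ) _, ← mul_assoc, mul_inv_cancel₀ (by positivity), one_mul]
          calc (coneConst * (4 * t ^ 2 * 2 ^ (k + 1))) ^ 3 * (coneConst * (16 * ((1 / 2 : ℝ) ^ k) ^ 3))
              = 1024 * coneConst ^ 4 * t ^ 6 * ((2 : ℝ) ^ (k + 1) * (1 / 2) ^ k) ^ 3 := by ring
            _ = 8192 * coneConst ^ 4 * t ^ 6 := by rw [h2]; ring
  have hsum := Finset.sum_le_sum hterm
  rw [Finset.sum_const, Finset.card_range, nsmul_eq_mul] at hsum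
  have hB : coneMeasure {z : ℍ | ‖z.im‖ ≤ (1 / 2 : ℝ) ^ (K + 1)} ≤ ENNReal.ofReal (coneConst * (16 * ((1 / 2 : ℝ) ^ (K + 1)) ^ 3)) :=
    coneMeasure_imBall_le (by positivity)
  calc (∑ k ∈ Finset.range (K + 1), ENNReal.ofReal ((coneConst * (4 * t ^ 2 * 2 ^ (k + 1))) ^ 3) *
          coneMeasure {z : ℍ | (1 / 2 : ℝ) ^ (k + 1) < ‖z.im‖ ∧ ‖z.im‖ ≤ (1 / 2) ^ k}) +
        coneMeasure {z : ℍ | ‖z.im‖ ≤ (1 / 2 : ℝ) ^ (K + 1)}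
      ≤ ((K + 1 : ℕ) : ℝ≥0∞) * ENNReal.ofReal (8192 * coneConst ^ 4 * t ^ 6) +
          ENNReal.ofReal (coneConst * (16 * ((1 / 2 : ℝ) ^ (K + 1)) ^ 3)) := add_le_add hsum hB
    _ = ENNReal.ofReal (((K + 1 : ℕ) : ℝ) * (8192 * coneConst ^ 4 * t ^ 6) + coneConst * (16 * ((1 / 2 : ℝ) ^ (K + 1)) ^ 3)) := by
        rw [ENNReal.ofReal_add (by positivity) (by positivity), ENNReal.ofReal_mul (Nat.cast_nonneg (K + 1)), ENNReal.ofReal_natCast]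

/-! ## §7 The ceiling -/

/-- ★★ **THE CEILING OF THE TORON LOGARITHM.**  There are `C > 0` and `t₀ > 0` (here `t₀ = 1/2`,
`C = 4·(24576·c⁴ + 16·c)/log 2`, `c = vol(B⁴)⁻¹ = 2/π²`) such that for `0 < t ≤ t₀` the product Haar measure of the quadruples
`(C_μ) ∈ SU(2)⁴` whose unit quaternions pairwise commute up to `t` is AT MOST `C·t⁶·log(1/t)`.  With ✓`haar_pi_nearlyCommuting_ge` the
`k = 4` zero-mode block has small-ball law `≍ t⁶ log(1/t)`: pole `3`, multiplicity `2` in `s = t²` — one logarithm, not two. [folklore] -/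
theorem haar_pi_nearlyCommuting_le :
    ∃ C : ℝ, 0 < C ∧ ∃ t₀ : ℝ, 0 < t₀ ∧ ∀ t : ℝ, 0 < t → t ≤ t₀ →
      (Measure.pi fun _ : Fin 4 => haarProbability (Matrix.specialUnitaryGroup (Fin 2) ℂ)).real
          {C : Fin 4 → (Matrix.specialUnitaryGroup (Fin 2) ℂ) | ∀ μ ν : Fin 4, ‖su2Quat (C μ) * su2Quat (C ν) - su2Quat (C ν) * su2Quat (C μ)‖ ≤ t} ≤
        C * t ^ 6 * Real.log t⁻¹ := by
  have hc := coneConst_pos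
  have hlog2 : 0 < Real.log 2 := Real.log_pos (by norm_num)
  refine ⟨4 * (24576 * coneConst ^ 4 + 16 * coneConst) / Real.log 2, by positivity, 1 / 2, by norm_num, fun t ht ht₀ => ?_⟩
  -- the number of shells: `2^K ≤ t⁻² < 2^{K+1}`
  have ht1 : t ≤ 1 := by linarith
  have hX1 : (1 : ℝ) ≤ (t ^ 2)⁻¹ := (one_le_inv₀ (by positivity)).2 (by nlinarith)
  obtain ⟨K, hK1, hK2⟩ := exists_nat_pow_near hX1 (by norm_num : (1 : ℝ) < 2)
  -- `log t⁻¹ ≥ log 2` and `K + 1 ≤ 3 log t⁻¹ / log 2`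
  have hlogt : Real.log 2 ≤ Real.log t⁻¹ := Real.log_le_log (by norm_num) (by rw [le_inv_comm₀ (by norm_num) ht]; linarith)
  have hlogt0 : 0 < Real.log t⁻¹ := lt_of_lt_of_le hlog2 hlogt
  have hKle : ((K + 1 : ℕ) : ℝ) ≤ 3 * Real.log t⁻¹ / Real.log 2 := by
    have h1 : (K : ℝ) * Real.log 2 ≤ 2 * Real.log t⁻¹ := by
      have h := Real.log_le_log (by positivity) hK1
      rw [Real.log_pow, Real.log_inv, Real.log_pow] at h
      push_cast at h
      rw [Real.log_inv]
      linarith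
    rw [le_div_iff₀ hlog2]
    push_cast
    nlinarith
  -- the tail shell: `2^{-(K+1)} ≤ t²`
  have htail : ((1 / 2 : ℝ) ^ (K + 1)) ^ 3 ≤ t ^ 6 := by
    have h1 : (1 / 2 : ℝ) ^ (K + 1) ≤ t ^ 2 := by
      rw [one_div, inv_pow]
      exact (inv_le_comm₀ (by positivity) (by positivity)).1 hK2.le
    calc ((1 / 2 : ℝ) ^ (K + 1)) ^ 3 ≤ (t ^ 2) ^ 3 := pow_le_pow_left₀ (by positivity) h1 3
      _ = t ^ 6 := by ring
  -- the bound in `ℝ≥0∞`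
  have hmain := haar_pi_le_sum_lintegral ht.le
  have hI := lintegral_integrand_le ht.le K
  have hfin : (Measure.pi fun _ : Fin 4 => haarProbability (Matrix.specialUnitaryGroup (Fin 2) ℂ)) (nearlyCommuting t) ≠ ∞ :=
    measure_ne_top _ _
  set R : ℝ := ((K + 1 : ℕ) : ℝ) * (8192 * coneConst ^ 4 * t ^ 6) + coneConst * (16 * ((1 / 2 : ℝ) ^ (K + 1)) ^ 3) with hR
  have hR0 : 0 ≤ R := by positivity
  have h4 : (Measure.pi fun _ : Fin 4 => haarProbability (Matrix.specialUnitaryGroup (Fin 2) ℂ)) (nearlyCommuting t) ≤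
      ENNReal.ofReal (4 * R) := by
    refine hmain.trans ?_
    rw [Finset.sum_const, Finset.card_univ, Fintype.card_fin, nsmul_eq_mul, show (4 : ℝ) * R = ((4 : ℕ) : ℝ) * R by norm_num,
      ENNReal.ofReal_mul (by positivity), ENNReal.ofReal_natCast]
    exact mul_le_mul_right hI _
  have hreal : ((Measure.pi fun _ : Fin 4 => haarProbability (Matrix.specialUnitaryGroup (Fin 2) ℂ)) (nearlyCommuting t)).toReal ≤ 4 * R :=
    ENNReal.toReal_le_of_le_ofReal (by positivity) h4
  show ((Measure.pi fun _ : Fin 4 => haarProbability (Matrix.specialUnitaryGroup (Fin 2) ℂ)) (nearlyCommuting t)).toReal ≤ _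
  refine hreal.trans ?_
  -- `4R ≤ C t⁶ log t⁻¹`
  have h1 : ((K + 1 : ℕ) : ℝ) * (8192 * coneConst ^ 4 * t ^ 6) ≤ 3 * Real.log t⁻¹ / Real.log 2 * (8192 * coneConst ^ 4 * t ^ 6) :=
    mul_le_mul_of_nonneg_right hKle (by positivity)
  have h2 : coneConst * (16 * ((1 / 2 : ℝ) ^ (K + 1)) ^ 3) ≤ 16 * coneConst * t ^ 6 * (Real.log t⁻¹ / Real.log 2) := by
    have h3 : 1 ≤ Real.log t⁻¹ / Real.log 2 := by rw [le_div_iff₀ hlog2]; linarith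
    calc coneConst * (16 * ((1 / 2 : ℝ) ^ (K + 1)) ^ 3) ≤ coneConst * (16 * t ^ 6) := by gcongr
      _ = 16 * coneConst * t ^ 6 * 1 := by ring
      _ ≤ 16 * coneConst * t ^ 6 * (Real.log t⁻¹ / Real.log 2) := mul_le_mul_of_nonneg_left h3 (by positivity)
  have e : 4 * (24576 * coneConst ^ 4 + 16 * coneConst) / Real.log 2 * t ^ 6 * Real.log t⁻¹ =
      4 * (3 * Real.log t⁻¹ / Real.log 2 * (8192 * coneConst ^ 4 * t ^ 6) + 16 * coneConst * t ^ 6 * (Real.log t⁻¹ / Real.log 2)) := by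
    field_simp
    ring
  rw [e, hR]
  linarith

/-- ★★ **Two-sided small-ball law of the 4-letter commutator** (✓`ToronLog.haar_pi_nearlyCommuting_ge` of seat w2 g54 and the ceiling above):
`c·t⁶·log(1/t) ≤ Haar⁴{pairwise ‖[q_μ, q_ν]‖ ≤ t} ≤ C·t⁶·log(1/t)` for `0 < t ≤ t₀`. [folklore] -/
theorem haar_pi_nearlyCommuting_two_sided :
    ∃ c : ℝ, 0 < c ∧ ∃ C : ℝ, 0 < C ∧ ∃ t₀ : ℝ, 0 < t₀ ∧ ∀ t : ℝ, 0 < t → t ≤ t₀ →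
      c * t ^ 6 * Real.log t⁻¹ ≤
          (Measure.pi fun _ : Fin 4 => haarProbability (Matrix.specialUnitaryGroup (Fin 2) ℂ)).real
            {C : Fin 4 → (Matrix.specialUnitaryGroup (Fin 2) ℂ) | ∀ μ ν : Fin 4, ‖su2Quat (C μ) * su2Quat (C ν) - su2Quat (C ν) * su2Quat (C μ)‖ ≤ t} ∧
        (Measure.pi fun _ : Fin 4 => haarProbability (Matrix.specialUnitaryGroup (Fin 2) ℂ)).real
            {C : Fin 4 → (Matrix.specialUnitaryGroup (Fin 2) ℂ) | ∀ μ ν : Fin 4, ‖su2Quat (C μ) * su2Quat (C ν) - su2Quat (C ν) * su2Quat (C μ)‖ ≤ t} ≤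
          C * t ^ 6 * Real.log t⁻¹ := by
  obtain ⟨c, hc, t₁, ht₁, hlow⟩ := haar_pi_nearlyCommuting_ge
  obtain ⟨C, hC, t₂, ht₂, hup⟩ := haar_pi_nearlyCommuting_le
  exact ⟨c, hc, C, hC, min t₁ t₂, lt_min ht₁ ht₂, fun t ht htle =>
    ⟨hlow t ht (htle.trans (min_le_left _ _)), hup t ht (htle.trans (min_le_right _ _))⟩⟩

end Summit.QuantumFields.YangMills.Theorems.ToronValleyVolume.NearlyCommutingCeiling

end
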